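import Literature.MathematicalPhysics.QuantumFieldTheory.Balaban1983to89.B8

/-!
# `Balaban1983to89.B8SectGH` — Proposition 7 (Sect. G) and Theorem 8 (Sect. H) of B8 with their PRINTED hypotheses

CITATION HEADER (lean-in-tree rule 2026-08-18).  Statement-fidelity repairs, found in the surge cross-read
(XREAD rows T05.7, T05.8; census GAPS G-pv17-3, G-pv17-4, DIVERGENCE D-pv17.3, D-pv17.4 of the audit cell
`pub-balaban`), of two typed statements of T. Bałaban, *Spaces of regular gauge field configurations on a
lattice and gauge fixing conditions*, Comm. Math. Phys. **99**, 75–102 (1985) [Balaban1985RegularSpaces]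
(cell paper B8; PDF held `paper:balaban1985-cmp99-regular-spaces-gauge-fixing`, journal page = PDF page + 74;
renders `…-p026-x2.png` (p. 100), `…-p027-x2.png` (p. 101), `…-p008-x2.png` (p. 82) re-read).  The paper is a
manuscript UNDER ADJUDICATION; nothing of it is asserted here: every `def … : Prop` below is a printed statement
typed as a proposition (to be used as a HYPOTHESIS), and every `theorem` is bookkeeping between typed forms.
`B8.lean` (reader r1, sub-cell b08) is NOT modified; this sibling module only adds the faithful forms next to it.

WHAT IS PRINTED.
* p. 100 [PDF 26], Sect. G: "We assume that we are given a gauge field configuration U₀, U₀ ∈ 𝔄_k({Ω_j}, α₀),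
  (1.139) and a Lie algebra valued configuration A satisfying
  L^jη|A|, (L^jη)²|∇^η_{U₀}A|, (L^jη)³|D^{η*}_{U₀}D^η_{U₀}A| < α₂ on Ω_j. (1.140)
  We consider the configuration U₁U₀, U₁ = e^{iηA}."  …  "**Proposition 7.** If the configurations U₀, A satisfy
  (1.139), (1.140), then for α₀, α₂ sufficiently small we have
  U′U₀ = (U₁U₀)^u ∈ 𝔄_k({Ω_j}, α₀ + 3α₂) ∩ Ax_k(𝔅_k, U₀), (1.144)
  |(U′U₀‾)^j − Ū₀^j| = |exp iQ_j(U₀, ηA) − 1| < 2α₂ on Ω^{(j)}_j. (1.145)"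
  The printed proof uses the second member of (1.140) in (1.141) ("η²|(D^η_{U₀}A)(p)|" ↦ the summand 2α₂) and the
  third in (1.142).
* p. 100 l. −1 – p. 101 [PDF 27], Sect. H: "… a more general condition of the form R(U₀)D^{η*}_{U₀}A = f, (1.146)
  where f is a function from the space R(U₀), i.e. a Lie algebra valued function defined on Ω₀ and satisfying
  R(U₀)f = f. Of course we have to assume that f is in a sufficiently small neighborhood of 0, for example it is
  enough to assume that |f|_{(−2)} < γ(α₀ + α₁) with a positive, not too big, constant γ, e.g. γ = 1. Inspecting
  the proofs of the theorems and propositions we can see easily that they work in this more general situation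
  almost without any changes, only some constants change their numerical values. Thus we have the following
  generalization of Theorem 2.  **Theorem 8.** There exist constants B₁, B₂(β₀), c₁ such that for arbitrary U₀,
  U′U₀ satisfying (1.33)–(1.35) with α₀ + α₁ ≤ c₁, and for an arbitrary function f from the space R(U₀)
  satisfying the bound |f|_{(−2)} < γ(α₀ + α₁), there exists exactly one gauge transformation u satisfying (1.29)
  and such, that the conditions (1.36), (1.37), (1.39), and (1.146) hold for the configuration U₁ = U′^{u⁻¹}. The
  constants B₁, B₂(β₀) are as in Theorems 2, 4, the constant c₁ depends on d, L and γ."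

WHAT `B8.lean` TYPES.  `B8.Prop7Printed` takes as hypothesis on A only `C162 1 α₂ U₀ U₁` = the FIRST member of
(1.140) (`C162 B s` := "|A| < B s (L^jη)^{−1} only", `GFData` docstring) — two printed hypotheses dropped, so the
typed proposition is stronger than the printed one (GAPS G-pv17-4; independently seen by surge seat pv14).
`B8.Thm8Printed` quantifies `∀ f : Src` with the sole f-hypothesis `fNorm f < γ (α₀ + α₁)`: the membership
"f from the space R(U₀)" (R(U₀)f = f) has no carrier predicate and is dropped (GAPS G-pv17-3) — with R(U₀) a
projection the equation (1.146) is unsolvable for R(U₀)f ≠ f, so the typed leaf is again stronger than print;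
and γ is universally quantified with B₁, B₂ fixed (DIVERGENCE D-pv17.3).

WHAT THIS FILE DOES.  A carrier extension `GFData3` (two predicates: `C140` = all three members of (1.140),
`InR` = "R(U₀)f = f"); the faithful forms `Prop7PrintedR`, `Thm8PrintedAt γ` (one γ, "e.g. γ = 1") and
`Thm8PrintedR` (all γ > 0, the literal reading of the theorem sentence); kernel-checked bookkeeping:
`prop7PrintedR_of_printed` and `thm8PrintedR_of_printed` (the forms typed in `B8.lean` IMPLY the faithful ones —
they are the stronger statements; the converse directions are not claimed), `thm8PrintedAt_anti` /
`thm8PrintedR_iff_large` (the family `Thm8PrintedAt γ` is antitone in γ, so the ∀γ reading is a statement about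
arbitrarily LARGE γ, the opposite of the printed "not too big"), `thm8PrintedAt_one_of_printed`.  Which form the
DAG leaf `B8.Concl` (fields `p7`, `t8`; `DagBinding` l. 702) should bind is the binding owner's decision; this
file only makes the faithful forms and the comparison available.  Unit `b2b-balaban-pv17` (surge node prover
#17, cross-reader of T05.6–T05.8).
-/

namespace Literature.MathematicalPhysics.QuantumFieldTheory.Balaban1983to89.B8SectGH

/-- Carrier extension of `B8.GFData2` by the two printed hypotheses that `B8.lean` has no predicate for:
`C140 α₂ U₀ U₁` = (1.140) p. 100, verbatim "L^jη|A|, (L^jη)²|∇^η_{U₀}A|, (L^jη)³|D^{η*}_{U₀}D^η_{U₀}A| < α₂ on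
Ω_j" for U₁ = e^{iηA} (all THREE members, j = 0, …, k); `InR U₀ f` = p. 101 "f is a function from the space
R(U₀), i.e. a Lie algebra valued function defined on Ω₀ and satisfying R(U₀)f = f".
[cite: Balaban1985RegularSpaces, (1.140) p.100 + (1.146) p.101] -/
structure GFData3 extends B8.GFData2 where
  C140 : ℝ → Cfg → Pert → Prop
  InR : Cfg → Src → Prop

variable {I : Type}

/-- **Proposition 7** (p. 100 [PDF 26], verbatim): *"If the configurations U₀, A satisfy (1.139), (1.140), then
for α₀, α₂ sufficiently small we have U′U₀ = (U₁U₀)^u ∈ 𝔄_k({Ω_j}, α₀ + 3α₂) ∩ Ax_k(𝔅_k, U₀), (1.144)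
|(U′U₀‾)^j − Ū₀^j| = |exp iQ_j(U₀, ηA) − 1| < 2α₂ on Ω^{(j)}_j. (1.145)"* — typed exactly as `B8.Prop7Printed`
except that the hypothesis on A is the printed (1.139)–(1.140) pair `InA α₀ U₀ ∧ C140 α₂ U₀ U₁` (all three
members of (1.140)) instead of the |A|-member alone.  As in `B8.Prop7Printed`, (1.145) is typed through the
(1.35)-predicate `avgClose (2α₂)` (printed on Λ_j ⊂ Ω^{(j)}_j, p. 82: a weakening of the printed conclusion,
DIVERGENCE D-pv17.4) and the gauge transformation u is abstracted into `toAxial`.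
[cite: Balaban1985RegularSpaces, Prop. 7 (1.144)–(1.145) p.100] -/
def Prop7PrintedR (fam : I → GFData3) (toAxial : ∀ i, (fam i).Cfg → (fam i).Pert → (fam i).Pert) : Prop :=
  ∃ c : ℝ, 0 < c ∧ ∀ i : I, ∀ α₀ α₂ : ℝ, 0 < α₀ → α₀ ≤ c → 0 < α₂ → α₂ ≤ c →
    ∀ U₀ : (fam i).Cfg, ∀ U₁ : (fam i).Pert, (fam i).InA α₀ U₀ → (fam i).C140 α₂ U₀ U₁ →
      (fam i).InAAx (α₀ + 3 * α₂) U₀ (toAxial i U₀ U₁) ∧ (fam i).avgClose (2 * α₂) U₀ (toAxial i U₀ U₁)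

/-- **Theorem 8** at ONE value of γ (p. 101 [PDF 27]; the preamble: "it is enough to assume that
|f|_{(−2)} < γ(α₀ + α₁) with a positive, not too big, constant γ, e.g. γ = 1"; the theorem: "the constant c₁
depends on d, L and γ"), verbatim statement in the module docstring — typed exactly as `B8.Thm8Printed` at this γ
except for the ADDED printed hypothesis `InR U₀ f` ("f from the space R(U₀)", i.e. R(U₀)f = f) before the norm
bound.  Hypotheses (1.33)–(1.35) = `InA`, `Reg335`, `InAAx`, `avgClose` and conclusions (1.36), (1.37), (1.39),
(1.146) = `C136`, `C137`, `C139`, `LandauF`, "exactly one … satisfying (1.29)" = ∃ u restricted ∧ … ∧ every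
restricted u′ with the same four properties equals u, all as in `B8.Thm8Printed`.
[cite: Balaban1985RegularSpaces, Thm 8 (1.146) p.101] -/
def Thm8PrintedAt (γ B₁ B₂ : ℝ) (fam : I → GFData3) : Prop :=
  ∃ c₁ : ℝ, 0 < c₁ ∧
    ∀ i : I, ∀ α₀ α₁ : ℝ, 0 < α₀ → 0 < α₁ → α₀ + α₁ ≤ c₁ →
      ∀ U₀ : (fam i).Cfg, ∀ U' : (fam i).Pert, ∀ f : (fam i).Src,
        (fam i).InA α₀ U₀ → (fam i).Reg335 α₀ U₀ → (fam i).InAAx α₀ U₀ U' → (fam i).avgClose α₁ U₀ U' →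
        (fam i).InR U₀ f → (fam i).fNorm f < γ * (α₀ + α₁) →
          ∃ u : (fam i).GT, (fam i).Restricted U₀ u ∧
            ((fam i).C136 B₁ B₂ (α₀ + α₁) U₀ ((fam i).act U' u) ∧ (fam i).C137 α₁ U₀ ((fam i).act U' u) ∧
              (fam i).C139 B₁ (α₀ + α₁) U₀ ((fam i).act U' u) ∧ (fam i).LandauF U₀ f ((fam i).act U' u)) ∧
            ∀ u' : (fam i).GT, (fam i).Restricted U₀ u' →
              (fam i).C136 B₁ B₂ (α₀ + α₁) U₀ ((fam i).act U' u') → (fam i).C137 α₁ U₀ ((fam i).act U' u') →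
              (fam i).C139 B₁ (α₀ + α₁) U₀ ((fam i).act U' u') → (fam i).LandauF U₀ f ((fam i).act U' u') →
                u' = u

/-- **Theorem 8** (p. 101 [PDF 27]) in the literal reading of its sentence "for an arbitrary function f from the
space R(U₀) satisfying the bound |f|_{(−2)} < γ(α₀ + α₁) … the constant c₁ depends on d, L and γ": every γ > 0,
with B₁, B₂ "as in Theorems 2, 4" independent of γ (the quantifier shape of `B8.Thm8Printed`, plus the membership
hypothesis).  See `thm8PrintedR_iff_large` for what this reading commits to.
[cite: Balaban1985RegularSpaces, Thm 8 (1.146) p.101] -/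
def Thm8PrintedR (B₁ B₂ : ℝ) (fam : I → GFData3) : Prop :=
  ∀ γ : ℝ, 0 < γ → Thm8PrintedAt γ B₁ B₂ fam

/-- Bookkeeping (kernel-checked): the form typed in `B8.lean` implies the faithful one — dropping two of the three
members of (1.140) made `B8.Prop7Printed` the STRONGER proposition.  The displayed law `hproj` says that the first
member of (1.140), "L^jη|A| < α₂", is the (1.62)-shape bound `C162 1 α₂` ("|A| < 1·α₂(L^jη)^{−1}"), which is how
`B8.lean` reads it; it holds by `rfl`-unfolding in any honest instance and is displayed rather than built into the
carrier. [folklore] -/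
theorem prop7PrintedR_of_printed (fam : I → GFData3)
    (toAxial : ∀ i, (fam i).Cfg → (fam i).Pert → (fam i).Pert)
    (hproj : ∀ i (α₂ : ℝ) (U₀ : (fam i).Cfg) (U₁ : (fam i).Pert),
      (fam i).C140 α₂ U₀ U₁ → (fam i).C162 1 α₂ U₀ U₁)
    (h : B8.Prop7Printed (fun i => (fam i).toGFData) toAxial) :
    Prop7PrintedR fam toAxial := by
  obtain ⟨c, hc, H⟩ := h
  exact ⟨c, hc, fun i α₀ α₂ h0 h0c h2 h2c U₀ U₁ hA h140 =>
    H i α₀ α₂ h0 h0c h2 h2c U₀ U₁ hA (hproj i α₂ U₀ U₁ h140)⟩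

/-- Bookkeeping (kernel-checked): the form typed in `B8.lean` implies the faithful one at every γ — the added
membership hypothesis `InR U₀ f` only weakens the statement.  (The converse is not claimed: it is exactly the
content that fails in an honest instance, GAPS G-pv17-3.) [folklore] -/
theorem thm8PrintedR_of_printed (B₁ B₂ : ℝ) (fam : I → GFData3)
    (h : B8.Thm8Printed B₁ B₂ (fun i => (fam i).toGFData)) : Thm8PrintedR B₁ B₂ fam := by
  intro γ hγ
  obtain ⟨c₁, hc₁, H⟩ := h γ hγ
  exact ⟨c₁, hc₁, fun i α₀ α₁ h0 h1 hs U₀ U' f hA hReg hAx hcl _hInR hf =>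
    H i α₀ α₁ h0 h1 hs U₀ U' f hA hReg hAx hcl hf⟩

/-- Bookkeeping (kernel-checked): `Thm8PrintedAt γ` is ANTITONE in γ — a larger γ admits more sources f under the
same constants B₁, B₂, so the statement gets stronger (0 < α₀ + α₁ makes γ′(α₀ + α₁) ≤ γ(α₀ + α₁)). [folklore] -/
theorem thm8PrintedAt_anti {γ γ' B₁ B₂ : ℝ} (fam : I → GFData3) (hle : γ' ≤ γ)
    (h : Thm8PrintedAt γ B₁ B₂ fam) : Thm8PrintedAt γ' B₁ B₂ fam := by
  obtain ⟨c₁, hc₁, H⟩ := h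
  refine ⟨c₁, hc₁, fun i α₀ α₁ h0 h1 hs U₀ U' f hA hReg hAx hcl hInR hf => ?_⟩
  have hf' : (fam i).fNorm f < γ * (α₀ + α₁) :=
    lt_of_lt_of_le hf (mul_le_mul_of_nonneg_right hle (by linarith))
  exact H i α₀ α₁ h0 h1 hs U₀ U' f hA hReg hAx hcl hInR hf'

/-- Bookkeeping (kernel-checked; DIVERGENCE D-pv17.3 made visible): because of the antitonicity, for any γ₀ > 0 the
∀γ reading `Thm8PrintedR` is equivalent to its restriction to γ ≥ γ₀ — i.e. it is a statement about arbitrarily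
LARGE γ with fixed B₁, B₂, whereas the printed preamble asks for "a positive, not too big, constant γ, e.g. γ = 1".
[folklore] -/
theorem thm8PrintedR_iff_large {γ₀ : ℝ} (hγ₀ : 0 < γ₀) (B₁ B₂ : ℝ) (fam : I → GFData3) :
    Thm8PrintedR B₁ B₂ fam ↔ ∀ γ : ℝ, γ₀ ≤ γ → Thm8PrintedAt γ B₁ B₂ fam := by
  constructor
  · intro h γ hγ
    exact h γ (lt_of_lt_of_le hγ₀ hγ)
  · intro h γ hγ
    rcases le_total γ₀ γ with hcase | hcase
    · exact h γ hcase
    · exact thm8PrintedAt_anti fam hcase (h γ₀ le_rfl)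

/-- Bookkeeping (kernel-checked): the printed "e.g. γ = 1" instance from either typed form. [folklore] -/
theorem thm8PrintedAt_one_of_R (B₁ B₂ : ℝ) (fam : I → GFData3) (h : Thm8PrintedR B₁ B₂ fam) :
    Thm8PrintedAt 1 B₁ B₂ fam :=
  h 1 one_pos

/-- Bookkeeping (kernel-checked): the printed "e.g. γ = 1" instance, with the membership hypothesis, from the form
typed in `B8.lean`. [folklore] -/
theorem thm8PrintedAt_one_of_printed (B₁ B₂ : ℝ) (fam : I → GFData3)
    (h : B8.Thm8Printed B₁ B₂ (fun i => (fam i).toGFData)) : Thm8PrintedAt 1 B₁ B₂ fam :=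
  thm8PrintedAt_one_of_R B₁ B₂ fam (thm8PrintedR_of_printed B₁ B₂ fam h)

end Literature.MathematicalPhysics.QuantumFieldTheory.Balaban1983to89.B8SectGH
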